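import Literature.Barriers.CriticalPhenomena.RigorousRGSmallParameterLatticeCutoff
import Literature.Barriers.CriticalPhenomena.RigorousRGSmallParameterSmallSetNeighbourhood
import HarnessLib

/-!
# `RigorousRGSmallParameter` (Slade, Theorem 1.4.1): the localisation bound
# `|⟨F, f⟩_0| ≤ N‖F‖_{T_0(𝔥,R)}` for `F ∈ 𝒩(U)` via a lattice cutoff ([BS-rg-loc] (e:FXbd) + Lemma 3.3.1)

Companion ("proof architecture") file of
`Literature/Barriers/CriticalPhenomena/RigorousRGSmallParameter.lean` (Loc norm-estimates layer).
[BS-rg-loc] §2.2: "if `F ∈ 𝒩(X)` then `⟨F,g⟩_φ = ⟨F,g - f⟩_φ`. Hence `|⟨F,g⟩_φ| ≤ ‖F‖_{T_φ}‖g - f‖_Φ`,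
and by taking the infimum over `f` we obtain `|⟨F,g⟩_φ| ≤ ‖F‖_{T_φ}‖g‖_{Φ(X)}` (e:FXbd)"; Lemma 3.3.1:
"`‖g‖_{Φ(X)} ≤ ‖gχ_t‖_{Φ(ℤ^d)} ≤ ((1+c₀t^{-1})𝔥^{-1})^p sup_{z∈X_{2t}} sup_{|β|_∞≤p_Φ}|∇_R^β g_z|`",
where `χ_t` "takes the value `1` if each variable lies in `X`, and the value `0` if any variable lies
in `ℤ^d∖X_{2t}`". This file PROVES the lattice form used downstream (at `φ = 0`, the only case
needed for Proposition 1.4.5): with the cutoff `χ` of `…LatticeCutoff`/`…TorusBump` around a box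
containing `U` (plateau radius `a₀`, `p_Φ` controlled differences of cost `2/w` each),
(i) `|∇^β(fχ)_z| ≤ leibnizBd(|β|)` everywhere (lattice Leibniz bound on the box regions — a region
system since a unit step changes each cyclic coordinate distance by at most one — and far vanishing
beyond them), (ii) `(fχ)/N ∈ B(Φ(𝔥,R))` for `N ≥ 𝔥^{-p}R^m leibnizBd(m)`, `m ≤ p_Φ p`, and hence
(iii) **`|⟨F,f⟩_0| = |⟨F,fχ⟩_0| ≤ N‖F‖_{T_0(𝔥,R)}`**. All PROVED, 0 sorry:

* cutoff: `cut1`, `abs_valMinAbs_sub_eq_cycDist`, `cut1_eq_one/_eq_zero/_mem_Icc`,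
  `abs_dirDiffs_cut1_le`, `cutPt` (+`_eq_one/_eq_zero`, `abs_fdiffs_cutPt_le`), `cutSeq`,
  `slotProd_const`, `cutSeq_eq_one/_eq_zero`, **`abs_napply_cutSeq_le`**;
* regions: `boxReg`, `mem_modify_iff`, `cycDist_add_unitStep_le`, `cycDist_le_add_unitStep`,
  **`regionSys_boxReg`**; far vanishing **`napply_eq_zero_of_far`**, `napply_mul_cutSeq_eq_zero_of_far`;
* assembly: **`abs_napply_mul_cutSeq_le`**, `napply_eq_zero_of_vanish`, `length_le_of_adm`,
  **`div_mem_ball_of_napply_le`**, **`abs_TphiPairing_le_of_local`**.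

Sources: D. C. Brydges, G. Slade, *A renormalisation group method. II. Approximation by local
polynomials*, J. Stat. Phys. 159 (2015) 461–491, arXiv:1403.7253, §2.2 (display (e:FXbd)) and §3.3
(Lemma 3.3.1 and its proof), TeX-source numbering.

## References

* [BrydgesSlade2015RGII] D. C. Brydges, G. Slade, *A renormalisation group method. II.
  Approximation by local polynomials*, J. Stat. Phys. **159** (2015) 461–491, arXiv:1403.7253.
-/

noncomputable section

namespace Literature.Barriers.CriticalPhenomena

namespace LongRangePhi4

namespace Loc

open Finset Tphi RGNorm LocalPoly Bump Polymer Literature.Probability.LatticeModels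

variable {d M n : ℕ} [NeZero M]

/-! ### The cutoff around a box -/

/-- One-coordinate cutoff with plateau radius `a₀` around `c`: the lifted bump on `[-a₀, a₀]`. [folklore] -/
def cut1 (c : ZMod M) (a₀ w K : ℕ) : ZMod M → ℝ := bumpM c (-(a₀ : ℤ)) a₀ w K

/-- `|z(y)| = cycDist(c, y)` for the centred coordinate `z(y) = (y - c).valMinAbs`. [folklore] -/
theorem abs_valMinAbs_sub_eq_cycDist (c y : ZMod M) : |(y - c).valMinAbs| = (cycDist c y : ℤ) := by
  rw [cycDist_eq_natAbs_valMinAbs, Int.natCast_natAbs]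

/-- The cutoff is `1` within cyclic distance `a₀` of the centre. [folklore] -/
theorem cut1_eq_one {c y : ZMod M} {a₀ w K : ℕ} (hw : 1 ≤ w) (h : cycDist c y ≤ a₀) : cut1 c a₀ w K y = 1 := by
  have hab := abs_valMinAbs_sub_eq_cycDist c y
  have h' : ((cycDist c y : ℕ) : ℤ) ≤ a₀ := by exact_mod_cast h
  refine bumpM_eq_one hw ?_ ?_ <;> [have := neg_abs_le (y - c).valMinAbs; have := le_abs_self (y - c).valMinAbs] <;> linarith

/-- The cutoff vanishes beyond cyclic distance `a₀ + K(w-1)`. [folklore] -/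
theorem cut1_eq_zero {c y : ZMod M} {a₀ w K : ℕ} (h : a₀ + K * (w - 1) < cycDist c y) : cut1 c a₀ w K y = 0 := by
  have hab := abs_valMinAbs_sub_eq_cycDist c y
  have h' : ((a₀ : ℤ) + K * (w - 1 : ℕ)) < (cycDist c y : ℕ) := by exact_mod_cast h
  refine bumpM_eq_zero ?_
  rcases abs_cases (y - c).valMinAbs with ⟨h1, _⟩ | ⟨h1, _⟩
  · right; linarith
  · left; linarith

omit [NeZero M] in
/-- Values in `[0,1]`. [folklore] -/
theorem cut1_mem_Icc (c y : ZMod M) (a₀ : ℕ) {w : ℕ} (K : ℕ) (hw : 1 ≤ w) : 0 ≤ cut1 c a₀ w K y ∧ cut1 c a₀ w K y ≤ 1 :=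
  bumpM_mem_Icc c _ _ K hw y

/-- **`|D_l cut1| ≤ (2/w)^{|l|}` for `|l| ≤ K`** when the support is inside the window:
`2(a₀ + K(w-1)) < M - 2K`. [folklore] -/
theorem abs_dirDiffs_cut1_le {c : ZMod M} {a₀ w K : ℕ} (hw : 1 ≤ w) (hwin : 2 * ((a₀ : ℤ) + K * (w - 1 : ℕ)) < (M : ℤ) - 2 * K)
    (l : List Bool) (hl : l.length ≤ K) (y : ZMod M) : |dirDiffs l (cut1 c a₀ w K) y| ≤ (2 / w) ^ l.length :=
  abs_dirDiffs_bumpM_le hw (by linarith) (by linarith) l hl y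

/-- The `d`-dimensional cutoff around the box of radius `a₀` centred at `c`. [folklore] -/
def cutPt (c : TorusSite d M) (a₀ w K : ℕ) : TorusSite d M → ℝ := coordProd fun j => cut1 (c j) a₀ w K

/-- Plateau: `cutPt = 1` on the box `{x | ∀ j, cycDist(c_j, x_j) ≤ a₀}`. [folklore] -/
theorem cutPt_eq_one {c x : TorusSite d M} {a₀ w K : ℕ} (hw : 1 ≤ w) (h : ∀ j, cycDist (c j) (x j) ≤ a₀) : cutPt c a₀ w K x = 1 := by
  unfold cutPt coordProd
  exact Finset.prod_eq_one fun j _ => cut1_eq_one hw (h j)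

/-- Support: `cutPt = 0` as soon as one coordinate is beyond `a₀ + K(w-1)`. [folklore] -/
theorem cutPt_eq_zero {c x : TorusSite d M} {a₀ w K : ℕ} (h : ∃ j, a₀ + K * (w - 1) < cycDist (c j) (x j)) : cutPt c a₀ w K x = 0 := by
  obtain ⟨j, hj⟩ := h
  unfold cutPt coordProd
  exact Finset.prod_eq_zero (Finset.mem_univ j) (cut1_eq_zero hj)

/-- **`|∇^L cutPt| ≤ (2/w)^{|L|}`** when at most `K` steps fall on each coordinate. [folklore] -/
theorem abs_fdiffs_cutPt_le {c : TorusSite d M} {a₀ w K : ℕ} (hw : 1 ≤ w) (hwin : 2 * ((a₀ : ℤ) + K * (w - 1 : ℕ)) < (M : ℤ) - 2 * K)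
    (L : List (Fin d × Bool)) (hK : ∀ j, (dirsAt j L).length ≤ K) (x : TorusSite d M) :
    |fdiffs (L.map (unitStep d M)) (cutPt c a₀ w K) x| ≤ (2 / w) ^ L.length :=
  abs_fdiffs_coordProd_le (fun _ l y hl => abs_dirDiffs_cut1_le hw hwin l hl y) L hK x

/-- The cutoff on sequences: `χ(z) = ∏_k cutPt(z_k)`. [folklore] -/
def cutSeq (c : TorusSite d M) (a₀ w K : ℕ) : List (TorusSite d M × Fin n) → ℝ := slotProd fun _ => cutPt c a₀ w K

omit [NeZero M] in
/-- A slot product of a constant family is the list product. [folklore] -/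
theorem slotProd_const (χ₁ : TorusSite d M → ℝ) : ∀ z : List (TorusSite d M × Fin n), slotProd (fun _ => χ₁) z = (z.map fun q => χ₁ q.1).prod
  | [] => rfl
  | q :: z => by rw [slotProd_cons, List.map_cons, List.prod_cons, slotProd_const χ₁ z]

/-- Plateau on sequences. [folklore] -/
theorem cutSeq_eq_one {c : TorusSite d M} {a₀ w K : ℕ} (hw : 1 ≤ w) {z : List (TorusSite d M × Fin n)}
    (h : ∀ q ∈ z, ∀ j, cycDist (c j) (q.1 j) ≤ a₀) : cutSeq c a₀ w K z = 1 := by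
  unfold cutSeq
  rw [slotProd_const]
  refine List.prod_eq_one fun t ht => ?_
  obtain ⟨q, hq, rfl⟩ := List.mem_map.1 ht
  exact cutPt_eq_one hw (h q hq)

/-- Support on sequences: one far component kills the cutoff. [folklore] -/
theorem cutSeq_eq_zero {c : TorusSite d M} {a₀ w K : ℕ} {z : List (TorusSite d M × Fin n)}
    (h : ∃ q ∈ z, ∃ j, a₀ + K * (w - 1) < cycDist (c j) (q.1 j)) : cutSeq c a₀ w K z = 0 := by
  obtain ⟨q, hq, hj⟩ := h
  unfold cutSeq
  rw [slotProd_const]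
  exact List.prod_eq_zero (List.mem_map.2 ⟨q, hq, cutPt_eq_zero hj⟩)

/-- **`|∇^β χ_z| ≤ (2/w)^{|β|}`** for programmes with at most `K` differences per slot. [folklore] -/
theorem abs_napply_cutSeq_le {c : TorusSite d M} {a₀ w K : ℕ} (hw : 1 ≤ w) (hwin : 2 * ((a₀ : ℤ) + K * (w - 1 : ℕ)) < (M : ℤ) - 2 * K)
    (β : List (ℕ × (Fin d × Bool))) (hβ : ∀ k, countAt k β ≤ K) (z : List (TorusSite d M × Fin n)) :
    |napply (unitStep d M) β (cutSeq c a₀ w K) z| ≤ (2 / w) ^ β.length :=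
  abs_napply_slotProd_le (by positivity) (fun L x hL => abs_fdiffs_cutPt_le hw hwin L hL x) β hβ z

/-! ### Box regions -/

/-- The box regions: all components within cyclic distance `b + r` of the centre, coordinatewise. [folklore] -/
def boxReg (c : TorusSite d M) (b : ℕ) : ℕ → List (TorusSite d M × Fin n) → Prop :=
  fun r z => ∀ q ∈ z, ∀ j, cycDist (c j) (q.1 j) ≤ b + r

omit [NeZero M] in
/-- Members of a modified list. [folklore] -/
theorem mem_modify_iff {α : Type*} (f : α → α) : ∀ (k : ℕ) (l : List α) (x : α),
    x ∈ l.modify k f → x ∈ l ∨ ∃ y ∈ l, x = f y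
  | _, [], x, h => by simp at h
  | 0, y :: l, x, h => by
      simp only [List.modify_zero_cons, List.mem_cons] at h
      rcases h with rfl | h
      · exact Or.inr ⟨y, by simp, rfl⟩
      · exact Or.inl (List.mem_cons_of_mem _ h)
  | k + 1, y :: l, x, h => by
      simp only [List.modify_succ_cons, List.mem_cons] at h
      rcases h with rfl | h
      · exact Or.inl (by simp)
      · rcases mem_modify_iff f k l x h with h' | ⟨y', hy', rfl⟩
        · exact Or.inl (List.mem_cons_of_mem _ h')
        · exact Or.inr ⟨y', List.mem_cons_of_mem _ hy', rfl⟩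

/-- A unit step moves each coordinate by cyclic distance at most one. [folklore] -/
theorem cycDist_add_unitStep_le (a : ZMod M) (x : TorusSite d M) (s : Fin d × Bool) (j : Fin d) :
    cycDist a ((x + unitStep d M s) j) ≤ cycDist a (x j) + 1 := by
  refine (cycDist_triangle a (x j) _).trans (Nat.add_le_add_left ?_ _)
  simp only [unitStep, Pi.add_apply, Pi.single_apply]
  split_ifs with h1 h2
  · exact cycDist_add_one_le _
  · have h := cycDist_add_one_le (x j + -1)
    rw [cycDist_comm, show x j + -1 + 1 = x j by ring] at h
    exact h
  · simp [cycDist, fdist]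

/-- A unit step moves each coordinate by cyclic distance at most one (reverse form). [folklore] -/
theorem cycDist_le_add_unitStep (a : ZMod M) (x : TorusSite d M) (s : Fin d × Bool) (j : Fin d) :
    cycDist a (x j) ≤ cycDist a ((x + unitStep d M s) j) + 1 := by
  refine (cycDist_triangle a ((x + unitStep d M s) j) (x j)).trans (Nat.add_le_add_left ?_ _)
  rw [cycDist_comm]
  have h := cycDist_add_unitStep_le (x j) x s j
  have h0 : cycDist (x j) (x j) = 0 := by simp [cycDist, fdist]
  omega

/-- **The box regions form a region system** (symmetric boxes make wrap-around harmless: a unit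
step changes a cyclic distance by at most one). [folklore] -/
theorem regionSys_boxReg (c : TorusSite d M) (b : ℕ) : RegionSys (unitStep d M) (boxReg (n := n) c b) := by
  refine ⟨fun r z h q hq j => (h q hq j).trans (by omega), fun r z k s h q hq j => ?_⟩
  rcases mem_modify_iff _ k z q hq with h' | ⟨y, hy, rfl⟩
  · exact (h q h' j).trans (by omega)
  · exact (cycDist_add_unitStep_le (c j) y.1 s j).trans (by have := h y hy j; omega)

/-! ### Far vanishing -/

/-- **Far vanishing of difference programmes**: if `g` vanishes whenever some component is beyond
cyclic distance `B` (in some coordinate), then `∇^β g_z = 0` whenever some component `z_k` is beyond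
`B + countAt k β` — the differences at slot `k` cannot bring it back. [folklore] -/
theorem napply_eq_zero_of_far {c : TorusSite d M} {B : ℕ} {g : List (TorusSite d M × Fin n) → ℝ}
    (hg : ∀ z, (∃ q ∈ z, ∃ j, B < cycDist (c j) (q.1 j)) → g z = 0) :
    ∀ (β : List (ℕ × (Fin d × Bool))) (z : List (TorusSite d M × Fin n)) (k : ℕ) (hk : k < z.length) (j : Fin d),
      B + countAt k β < cycDist (c j) ((z[k]).1 j) → napply (unitStep d M) β g z = 0
  | [], z, k, hk, j, h => by
      rw [napply_nil]
      exact hg z ⟨z[k], List.getElem_mem hk, j, by simpa [countAt] using h⟩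
  | q :: β, z, k, hk, j, h => by
      rw [napply_cons]
      simp only [diffOp]
      have hc : countAt k β + (if q.1 = k then 1 else 0) = countAt k (q :: β) := by
        unfold countAt; simp only [List.map_cons, List.count_cons, beq_iff_eq]
      have h1 : napply (unitStep d M) β g z = 0 :=
        napply_eq_zero_of_far hg β z k hk j (by split_ifs at hc <;> omega)
      have hk' : k < (shiftAt q.1 (unitStep d M q.2) z).length := by simpa using hk
      have h2 : napply (unitStep d M) β g (shiftAt q.1 (unitStep d M q.2) z) = 0 := by
        refine napply_eq_zero_of_far hg β _ k hk' j ?_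
        unfold shiftAt
        simp only [List.getElem_modify]
        by_cases hq : q.1 = k
        · rw [if_pos hq]
          rw [if_pos hq] at hc
          dsimp only
          have hstep := cycDist_le_add_unitStep (c j) (z[k]).1 q.2 j
          omega
        · rw [if_neg hq]
          rw [if_neg hq] at hc
          omega
      rw [h1, h2, sub_self]

/-- Far vanishing for the cutoff product `fχ`: a component beyond `a₀ + K(w-1) + countAt` kills `∇^β(fχ)`. [folklore] -/
theorem napply_mul_cutSeq_eq_zero_of_far {c : TorusSite d M} {a₀ w K : ℕ} (f : List (TorusSite d M × Fin n) → ℝ)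
    (β : List (ℕ × (Fin d × Bool))) (z : List (TorusSite d M × Fin n)) (k : ℕ) (hk : k < z.length) (j : Fin d)
    (h : a₀ + K * (w - 1) + countAt k β < cycDist (c j) ((z[k]).1 j)) :
    napply (unitStep d M) β (fun z => f z * cutSeq c a₀ w K z) z = 0 :=
  napply_eq_zero_of_far (fun z hz => by rw [cutSeq_eq_zero hz, mul_zero]) β z k hk j h

end Loc

namespace Loc

open Finset Tphi RGNorm LocalPoly Bump Polymer Literature.Probability.LatticeModels
open scoped ContDiff

variable {d M n : ℕ} [NeZero M]

/-! ### The localisation bound -/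

/-- The index of a member. [folklore] -/
theorem exists_getElem_eq_of_mem {α : Type*} {l : List α} {x : α} (h : x ∈ l) : ∃ (k : ℕ) (hk : k < l.length), l[k] = x :=
  List.getElem_of_mem h

/-- **Derivative bound for `fχ` everywhere** (cutoff radius `a₀`, `K = p_Φ` controlled differences,
support margin `b = a₀ + p_Φ(w-1) + p_Φ`): on the base region by the lattice Leibniz bound, beyond
it by far vanishing. [cite: BrydgesSlade2015RGII, §3.3 (proof of Lemma 3.3.1)] -/
theorem abs_napply_mul_cutSeq_le {c : TorusSite d M} {a₀ w pΦ : ℕ} (hw : 1 ≤ w)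
    (hwin : 2 * ((a₀ : ℤ) + pΦ * (w - 1 : ℕ)) < (M : ℤ) - 2 * pΦ)
    {Ff : ℕ → ℕ → ℝ} (hF0 : ∀ r i, 0 ≤ Ff r i) (hFm : ∀ r r' i, r ≤ r' → Ff r i ≤ Ff r' i)
    {f : List (TorusSite d M × Fin n) → ℝ}
    (hf : DerivBd (unitStep d M) (boxReg (n := n) c (a₀ + pΦ * (w - 1) + pΦ)) (fun _ => pΦ) Ff f)
    (β : List (ℕ × (Fin d × Bool))) (hβ : ∀ k, countAt k β ≤ pΦ) (z : List (TorusSite d M × Fin n)) :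
    |napply (unitStep d M) β (fun w' => f w' * cutSeq c a₀ w pΦ w') z| ≤
      leibnizBd Ff (fun _ i => (2 / w : ℝ) ^ i) 0 β.length := by
  by_cases hz : boxReg (n := n) c (a₀ + pΦ * (w - 1) + pΦ) 0 z
  · refine abs_napply_mul_le (unitStep d M) (regionSys_boxReg c _) β (fun _ => pΦ) Ff (fun _ i => (2 / w : ℝ) ^ i)
      f (cutSeq c a₀ w pΦ) hβ hF0 (fun _ _ => by positivity) hFm (fun _ _ _ _ => le_rfl) hf ?_ 0 z hz
    intro r γ z' hγ _
    exact abs_napply_cutSeq_le hw hwin γ hγ z'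
  · -- far vanishing
    unfold boxReg at hz
    push Not at hz
    obtain ⟨q, hq, j, hj⟩ := hz
    obtain ⟨k, hk, rfl⟩ := exists_getElem_eq_of_mem hq
    rw [napply_mul_cutSeq_eq_zero_of_far f β z k hk j (by have := hβ k; omega), abs_zero]
    unfold leibnizBd
    exact Finset.sum_nonneg fun ij _ => by have := hF0 (0 + β.length) ij.1; positivity

omit [NeZero M] in
/-- `∇^α` of a test function vanishing at a length vanishes at that length. [folklore] -/
theorem napply_eq_zero_of_vanish {S : Type*} (step : S → TorusSite d M) (α : List (ℕ × S)) {g : List (TorusSite d M × Fin n) → ℝ}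
    {r : ℕ} (hg : ∀ w, w.length = r → g w = 0) (z : List (TorusSite d M × Fin n)) (hz : z.length = r) :
    napply step α g z = 0 := by
  rw [napply_congr step α (g' := fun _ => (0 : ℝ)) (r := r) (fun w hw => hg w hw) z hz]
  have : napply step α (fun _ : List (TorusSite d M × Fin n) => (0 : ℝ)) = 0 := napply_zero step α
  rw [this]; rfl

/-- Admissible programmes have at most `p_Φ |z|` differences. [folklore] -/
theorem length_le_of_adm {S : Type*} {pΦ r : ℕ} {α : List (ℕ × S)} (hα : Adm pΦ r α) : α.length ≤ pΦ * r := by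
  have h1 : ∀ (α : List (ℕ × S)), (∀ q ∈ α, q.1 < r) → α.length = ∑ k ∈ range r, countAt k α := by
    intro α hα1
    induction α with
    | nil => simp [countAt]
    | cons q α ih =>
        have hq := hα1 q (by simp)
        have ih' := ih fun q' hq' => hα1 q' (List.mem_cons_of_mem _ hq')
        unfold countAt at ih' ⊢
        simp only [List.map_cons, List.count_cons, beq_iff_eq, Finset.sum_add_distrib, List.length_cons]
        rw [Finset.sum_ite_eq (range r) q.1 (fun _ => 1), if_pos (Finset.mem_range.2 hq), ih']
  rw [h1 α hα.1]
  calc ∑ k ∈ range r, countAt k α ≤ ∑ k ∈ range r, pΦ := Finset.sum_le_sum fun k _ => hα.2 k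
    _ = pΦ * r := by rw [Finset.sum_const, Finset.card_range, smul_eq_mul, mul_comm]

omit [NeZero M] in
/-- **`(fχ)/N ∈ B(Φ(𝔥,R))`**: for a `p`-variable test function `f` (`p ≤ p_𝒩`) whose product with the
cutoff obeys `|∇^α(fχ)_z| ≤ Lb(|α|)` for programmes within budget `p_Φ`, and `N ≥ 𝔥^{-p}R^{n}Lb(n)`
for `n ≤ p_Φ p`. [cite: BrydgesSlade2015RGII, §3.3 (proof of Lemma 3.3.1: "‖gχ_t‖_Φ ≤ …")] -/
theorem div_mem_ball_of_napply_le {𝔥 R : ℝ} (h𝔥 : 0 < 𝔥) (hR : 0 < R) {pΦ pN p : ℕ} (hp : p ≤ pN)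
    {h : List (TorusSite d M × Fin n) → ℝ} (hhp : ∀ z, z.length ≠ p → h z = 0)
    {Lb : ℕ → ℝ} (hLb : ∀ (α : List (ℕ × (Fin d × Bool))) z, (∀ k, countAt k α ≤ pΦ) → |napply (unitStep d M) α h z| ≤ Lb α.length)
    {N : ℝ} (hN : 0 < N) (hNb : ∀ m, m ≤ pΦ * p → Lb m * R ^ m ≤ N * 𝔥 ^ p) :
    (fun z => N⁻¹ * h z) ∈ ball pN (latticeFamily (unitStep d M) 𝔥 R pΦ) := by
  refine ⟨fun z hz => by show N⁻¹ * h z = 0; rw [hhp z (by omega), mul_zero], ?_⟩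
  rintro ℓ ⟨α, z, hα, rfl⟩
  rw [latticeFun_apply]
  have e : napply (unitStep d M) α (fun z => N⁻¹ * h z) = fun z => N⁻¹ * napply (unitStep d M) α h z := by
    have := napply_smul (unitStep d M) α N⁻¹ h
    simpa [Pi.smul_def, smul_eq_mul] using this
  rw [e]
  by_cases hz : z.length = p
  · show |(𝔥 ^ z.length)⁻¹ * R ^ α.length * (N⁻¹ * napply (unitStep d M) α h z)| ≤ 1
    have hα' := hLb α z hα.2
    have hlen : α.length ≤ pΦ * p := hz ▸ length_le_of_adm hα
    have hNb' := hNb α.length hlen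
    rw [hz, abs_mul, abs_mul, abs_mul, abs_inv, abs_of_pos (pow_pos h𝔥 p), abs_of_pos (pow_pos hR _), abs_inv, abs_of_pos hN]
    have h1 : 0 < 𝔥 ^ p := pow_pos h𝔥 p
    have h2 : 0 < R ^ α.length := pow_pos hR _
    rw [show (𝔥 ^ p)⁻¹ * R ^ α.length * (N⁻¹ * |napply (unitStep d M) α h z|) =
        (R ^ α.length * |napply (unitStep d M) α h z|) / (N * 𝔥 ^ p) by field_simp, div_le_one (by positivity)]
    calc R ^ α.length * |napply (unitStep d M) α h z| ≤ R ^ α.length * Lb α.length := by gcongr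
      _ = Lb α.length * R ^ α.length := mul_comm _ _
      _ ≤ N * 𝔥 ^ p := hNb'
  · show |(𝔥 ^ z.length)⁻¹ * R ^ α.length * (N⁻¹ * napply (unitStep d M) α h z)| ≤ 1
    rw [napply_eq_zero_of_vanish (unitStep d M) α (r := z.length) (fun w hw => hhp w (by omega)) z rfl]
    simp

/-- **The localisation bound** ([BS-rg-loc] Lemma 3.3.1 with (e:FXbd), lattice form): let
`F ∈ 𝒩(U)` with `U` inside the plateau box of the cutoff, and `f` a `p`-variable test function
(`p ≤ p_𝒩`) with derivative bounds `Ff` on the box regions; if `N > 0` dominates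
`𝔥^{-p} R^m leibnizBd(Ff, (2/w)^·)(m)` for `m ≤ p_Φ p`, then `|⟨F, f⟩_0| ≤ N ‖F‖_{T_0(𝔥,R)}`
("`|⟨F,g⟩_φ| ≤ ‖F‖_{T_φ}‖g‖_{Φ(X)}`, `‖g‖_{Φ(X)} ≤ ‖gχ_t‖_Φ ≤ …`").
[cite: BrydgesSlade2015RGII, §2.2 (display (e:FXbd)) and Lemma 3.3.1] -/
theorem abs_TphiPairing_le_of_local {𝔥 R : ℝ} (h𝔥 : 0 < 𝔥) (hR : 0 < R) {pΦ pN p : ℕ} (hp : p ≤ pN)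
    {c : TorusSite d M} {a₀ w : ℕ} (hw : 1 ≤ w) (hwin : 2 * ((a₀ : ℤ) + pΦ * (w - 1 : ℕ)) < (M : ℤ) - 2 * pΦ)
    {U : Finset (TorusSite d M)} (hU : ∀ x ∈ U, ∀ j, cycDist (c j) (x j) ≤ a₀)
    {F : (TorusSite d M → Fin n → ℝ) → ℝ} (hFU : DependsOn U F) (hFs : ContDiff ℝ ∞ F)
    {f : List (TorusSite d M × Fin n) → ℝ} (hfp : ∀ z, z.length ≠ p → f z = 0)
    {Ff : ℕ → ℕ → ℝ} (hF0 : ∀ r i, 0 ≤ Ff r i) (hFm : ∀ r r' i, r ≤ r' → Ff r i ≤ Ff r' i)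
    (hf : DerivBd (unitStep d M) (boxReg (n := n) c (a₀ + pΦ * (w - 1) + pΦ)) (fun _ => pΦ) Ff f)
    {N : ℝ} (hN : 0 < N)
    (hNb : ∀ m, m ≤ pΦ * p → leibnizBd Ff (fun _ i => (2 / w : ℝ) ^ i) 0 m * R ^ m ≤ N * 𝔥 ^ p) :
    |TphiPairing pN (basisDir d M n) F 0 f| ≤ N * TphiNorm pN (latticeFamily (unitStep d M) 𝔥 R pΦ) (basisDir d M n) F 0 := by
  set h : List (TorusSite d M × Fin n) → ℝ := fun z => f z * cutSeq c a₀ w pΦ z with hh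
  -- `⟨F, f⟩_0 = ⟨F, h⟩_0`
  have e1 : TphiPairing pN (basisDir d M n) F 0 f = TphiPairing pN (basisDir d M n) F 0 h := by
    refine TphiPairing_congr_of_dependsOn hFU hFs pN 0 fun z hz => ?_
    rw [hh]
    simp only
    rw [cutSeq_eq_one hw fun q hq j => hU q.1 (hz q hq) j, mul_one]
  -- `h / N ∈ B(Φ)`
  have hball := div_mem_ball_of_napply_le (pΦ := pΦ) h𝔥 hR hp (h := h) (fun z hz => by rw [hh]; simp only; rw [hfp z hz, zero_mul])
    (fun α z hα => abs_napply_mul_cutSeq_le hw hwin hF0 hFm hf α hα z) hN hNb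
  have e2 : TphiPairing pN (basisDir d M n) F 0 h = N * TphiPairing pN (basisDir d M n) F 0 (fun z => N⁻¹ * h z) := by
    unfold TphiPairing
    rw [pairing_smul_right, ← mul_assoc, mul_inv_cancel₀ hN.ne', one_mul]
  rw [e1, e2, abs_mul, abs_of_pos hN]
  exact mul_le_mul_of_nonneg_left (abs_TphiPairing_le_lattice (unitStep d M) h𝔥 hR pΦ pN (basisDir d M n) F 0 hball) hN.le

end Loc

end LongRangePhi4

end Literature.Barriers.CriticalPhenomena
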